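import Mathlib.RingTheory.Ideal.KrullsHeightTheorem
import Mathlib.RingTheory.Artinian.Ring
import Literature.Computability.AlgebraicComplexity.KV22PowerSumDeterminantalComplexity
import Literature.Computability.AlgebraicComplexity.HessianAtOrigin
import HarnessLib

/-!
# Kumar–Volk 2022, proofs: `dc(x₁ⁿ + ⋯ + xₙⁿ) ≥ 1.5 n − 3` is a theorem of the tree

Companion (theorems only) of `KV22PowerSumDeterminantalComplexity.lean` (cell val-lit, seat t17 g2,
row KV22-A): M. Kumar, B. L. Volk, *A lower bound on determinantal complexity*, comput.
complexity **31** (2022) 12 = CCC 2021 = arXiv:2009.02452 (HELD, `paper:arxiv-2009.02452`,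
chunks `p0001`–`p0010`; bib `KumarVolk2022b`). It DISCHARGES the four named facts of that file —
`kumarVolk2022_lemma_4_holds`, `kumarVolk2022_lemma_5_holds`, `kumarVolk2022_lemma_11_holds`,
`kumarVolk2022_thm_1_holds` — by the PRINTED proof (§3), step for step, over EVERY field whose
characteristic does not divide the exponent (the source's §1.3 remark; algebraic closure is never
used), and then specialises. Honest framing: a kernel-checked linear-factor lower bound for the
determinantal complexity of the power sum; `VP ≠ VNP` is NOT proved and nothing here is progress
on it.

## Architecture (printed proof ↦ declarations)

* §2 / Lemma 4 ([CKSV19, K19] width lemma) ↦ `KumarVolk.width_lemma_zero` (common zero at the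
  origin, the form Lemma 11 uses) and `KumarVolk.width_lemma` (arbitrary common zero, by the
  translation `transl a`). Proof as in [CKSV19]: differentiate the identity
  `Σ x_i^d = Σ_j P_j Q_j + P'` to get `d x_i^{d−1} − ∂_i P' ∈ I = (P_j, Q_j)`; the quotient by
  `(x_i^{d−1} − d⁻¹ ∂_i P' : i)` is module-finite over `K` (monomial reduction,
  `KumarVolk.moduleFinite_quotient_of_pow_sub_mem`), so a minimal prime of `I` inside `𝔪₀` is
  maximal, i.e. `= 𝔪₀`, of height `n` (`height_ker_constantCoeff`), while Krull's height theorem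
  (`Ideal.height_le_card_of_mem_minimalPrimes_span_finset`) bounds it by the `2t` generators.
* §3.1 / Lemma 5 (normal form) ↦ `KumarVolk.lemma_5_general` (for `n > 4`, where the printed proof
  applies): `rank M(0) = m − 1` (Lemma 8 + Fact 9 = tree `alperBogartVelasco2017_prop_2_1_rank_zero`
  + `kumarVolk2022_fact_9`), `V M(0) U = Λ_{i₀}` (tree `exists_mul_mul_eq_lamMatrix`), determinant
  corrected on the `i₀`-th column, and the transposition `(1 i₀)`.
* §3.2 / Lemma 11 ↦ `KumarVolk.lemma_11_general`: Laplace expansion along the first row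
  (`Matrix.det_succ_row_zero`); `det N_{1,1}` has constant term `1`, the other first-row minors are
  constant free (`IsNormalForm.constantCoeff_det_minor_zero/_ne_zero`); the resulting `m + 2`
  products of constant-free polynomials feed `width_lemma_zero`.
* §3.3 / proof of Thm. 1 ↦ `KumarVolk.thm_1_core` (the Schur step, Lemma 10 cleared of
  denominators: `M · [[det D · 1, 0], [−adj D · C, 1]] = [[N, B], [0, D]]` with
  `N = det D · A − B · adj D · C`, hence `det N = (Σ x_i^n)(det D)^{m−n+1}`, `deg N ≤ n − 1`, `N` in
  normal form) and `KumarVolk.thm_1_general` (any field with `(n : K) ≠ 0`, every `n ≥ 5`).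
* Discharges: `kumarVolk2022_lemma_4_holds`, `kumarVolk2022_lemma_5_holds`,
  `kumarVolk2022_lemma_11_holds`, `kumarVolk2022_thm_1_holds` (over `ℂ`, `n ≥ 6`, as printed).

Deviations from print (all inessential, disclosed): ideals/heights instead of varieties/dimensions
(the tree's dictionary, `ABV17SingularLocusBound.lean`); Lemma 10 is used in the polynomial form
above rather than over the fraction field; the normal-form step rescales one column instead of
choosing `det G₁ = det G₂ = 1`.

## References

* [KumarVolk2022b] M. Kumar, B. L. Volk, comput. complexity 31 (2022) 12; CCC 2021; arXiv:2009.02452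
  — Thm. 1, Lemmas 4, 5, 10, 11, §3.3.
* [ChatterjeeKumarSheVolk2022] P. Chatterjee, M. Kumar, A. She, B. L. Volk, comput. complexity 31
  (2022), arXiv:1911.11793 — the width lemma.
* [AlperBogartVelasco2017] J. Alper, T. Bogart, M. Velasco, Found. Comput. Math. 17 (2017) — Lemma 8.
-/

noncomputable section

open MvPolynomial Matrix Finset

namespace Literature.Computability.AlgebraicComplexity


namespace KumarVolk

/-! ### Degree bookkeeping -/

section Degree

variable {R : Type*} [CommRing R] {σ : Type*}

/-- A partial derivative lowers the total degree by one. [folklore] -/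
private theorem totalDegree_pderiv_le (i : σ) (p : MvPolynomial σ R) :
    (pderiv i p).totalDegree ≤ p.totalDegree - 1 := by
  classical
  conv_lhs => rw [p.as_sum]
  rw [map_sum]
  refine totalDegree_finsetSum_le fun s hs => ?_
  rw [pderiv_monomial]
  by_cases hsi : s i = 0
  · simp [hsi]
  · refine (totalDegree_monomial_le _ _).trans ?_
    have hle : Finsupp.single i 1 ≤ s := by
      rw [Finsupp.single_le_iff]; omega
    have h1 : ((s - Finsupp.single i 1).sum fun _ e => e) + 1 = s.sum fun _ e => e := by
      conv_rhs => rw [← tsub_add_cancel_of_le hle]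
      rw [Finsupp.sum_add_index' (fun _ => rfl) (fun _ _ _ => rfl), Finsupp.sum_single_index rfl]
    have h1' : ((s - Finsupp.single i 1).sum fun _ => id) =
        (s - Finsupp.single i 1).sum fun _ e => e := rfl
    have h2 : (s.sum fun _ e => e) ≤ p.totalDegree := le_totalDegree hs
    omega

/-- `deg (C a * p) ≤ deg p`. [folklore] -/
private theorem totalDegree_C_mul_le (a : R) (p : MvPolynomial σ R) :
    (C a * p).totalDegree ≤ p.totalDegree :=
  (totalDegree_mul _ _).trans (by rw [totalDegree_C, zero_add])

/-- The determinant of a square matrix of polynomials of total degree `≤ e` has total degree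
`≤ (size) · e` (expand over permutations; Kumar–Volk §3.3, p0007: "`det(D)` … has degree at
most `n − 2`" for the affine `(n−2) × (n−2)` block). [cite: KumarVolk2022b, Thm. 1 (proof, §3.3)] -/
theorem totalDegree_det_le {ι : Type*} [Fintype ι] [DecidableEq ι]
    (A : Matrix ι ι (MvPolynomial σ R)) {e : ℕ} (hA : ∀ i j, (A i j).totalDegree ≤ e) :
    A.det.totalDegree ≤ Fintype.card ι * e := by
  rw [Matrix.det_apply']
  refine totalDegree_finsetSum_le fun τ _ => ?_
  calc (((Equiv.Perm.sign τ : ℤ) : MvPolynomial σ R) * ∏ i, A (τ i) i).totalDegree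
      ≤ ((Equiv.Perm.sign τ : ℤ) : MvPolynomial σ R).totalDegree +
          (∏ i, A (τ i) i).totalDegree := totalDegree_mul _ _
    _ ≤ 0 + ∑ i, (A (τ i) i).totalDegree := by
        refine add_le_add (le_of_eq ?_) (totalDegree_finsetProd _ _)
        rw [← map_intCast (C : R →+* MvPolynomial σ R), totalDegree_C]
    _ ≤ 0 + ∑ _i : ι, e := by
        exact add_le_add le_rfl (Finset.sum_le_sum fun i _ => hA _ _)
    _ = Fintype.card ι * e := by simp [Finset.card_univ]

end Degree

/-! ### Lemma 4: the width lemma (constant-free form, any field with `(d : K) ≠ 0`) -/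

section Width

variable {K : Type*} [Field K] {n : ℕ}

/-- Monomial reduction: if `x_i^{e+1} ≡ h_i (mod J)` with `deg h_i ≤ e` for every variable, then
`K[x]/J` is spanned by the monomials with all exponents `≤ e`, hence module-finite over `K` —
the finiteness behind the width lemma (Kumar–Volk Lemma 4, proved in [CKSV19, K19]: the common
zero set of `d x_i^{d−1} − ∂_i P'` is finite). [cite: KumarVolk2022b, Lemma 4 (proof, via [CKSV19])] -/
theorem moduleFinite_quotient_of_pow_sub_mem {e : ℕ} (J : Ideal (MvPolynomial (Fin n) K))
    (h : Fin n → MvPolynomial (Fin n) K) (hdeg : ∀ i, (h i).totalDegree ≤ e)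
    (hmem : ∀ i, X i ^ (e + 1) - h i ∈ J) :
    Module.Finite K (MvPolynomial (Fin n) K ⧸ J) := by
  classical
  -- the finite set of small monomials
  let B : Finset (Fin n →₀ ℕ) :=
    (Finset.univ : Finset (Fin n → Fin (e + 1))).image
      fun f => Finsupp.equivFunOnFinite.symm fun i => (f i : ℕ)
  have hB : ∀ s : Fin n →₀ ℕ, (∀ i, s i ≤ e) → s ∈ B := by
    intro s hs
    refine Finset.mem_image.2 ⟨fun i => ⟨s i, Nat.lt_succ_of_le (hs i)⟩, Finset.mem_univ _, ?_⟩
    ext i; simp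
  let mk : MvPolynomial (Fin n) K →ₐ[K] MvPolynomial (Fin n) K ⧸ J := Ideal.Quotient.mkₐ K J
  let S : Submodule K (MvPolynomial (Fin n) K ⧸ J) :=
    Submodule.span K ((B.image fun s => mk (monomial s 1) : Finset _) : Set _)
  -- every monomial reduces into `S`, by strong induction on the degree
  have hsmul : ∀ (u : Fin n →₀ ℕ) (c : K), mk (monomial u c) = c • mk (monomial u 1) := by
    intro u c
    have : monomial u c = c • monomial u (1 : K) := by rw [smul_monomial, smul_eq_mul, mul_one]
    rw [this, map_smul]
  have key : ∀ s : Fin n →₀ ℕ, mk (monomial s 1) ∈ S := by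
    intro s
    obtain ⟨N, hN⟩ : ∃ N, (s.sum fun _ k => k) = N := ⟨_, rfl⟩
    induction N using Nat.strong_induction_on generalizing s with
    | h N ih =>
    by_cases hsmall : ∀ i, s i ≤ e
    · exact Submodule.subset_span (Finset.mem_coe.2 (Finset.mem_image.2 ⟨s, hB s hsmall, rfl⟩))
    push Not at hsmall
    obtain ⟨i, hi⟩ := hsmall
    -- split off `x_i^{e+1}`
    have hle : Finsupp.single i (e + 1) ≤ s := by
      rw [Finsupp.single_le_iff]; omega
    set s' := s - Finsupp.single i (e + 1) with hs'
    have hss' : s = s' + Finsupp.single i (e + 1) := (tsub_add_cancel_of_le hle).symm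
    have hdeg_s' : (s'.sum fun _ k => k) + (e + 1) = s.sum fun _ k => k := by
      conv_rhs => rw [hss']
      rw [Finsupp.sum_add_index' (fun _ => rfl) (fun _ _ _ => rfl), Finsupp.sum_single_index rfl]
    have hdeg_s'' : (s'.sum fun _ => id) = s'.sum fun _ k => k := rfl
    have hmono : (monomial s (1 : K)) = monomial s' 1 * X i ^ (e + 1) := by
      rw [X_pow_eq_monomial, monomial_mul, mul_one, ← hss']
    -- `x^s ≡ x^{s'} h_i (mod J)`
    have hequiv : mk (monomial s 1) = mk (monomial s' 1 * h i) := by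
      rw [hmono]
      change Ideal.Quotient.mk J _ = Ideal.Quotient.mk J _
      rw [Ideal.Quotient.eq, ← mul_sub]
      exact Ideal.mul_mem_left _ _ (hmem i)
    rw [hequiv]
    -- expand `x^{s'} h_i` into monomials of degree `< deg s`
    have hprod_deg : (monomial s' (1 : K) * h i).totalDegree < N := by
      refine lt_of_le_of_lt (totalDegree_mul _ _) ?_
      have := totalDegree_monomial_le s' (1 : K)
      have := hdeg i
      omega
    rw [(monomial s' (1 : K) * h i).as_sum, map_sum]
    refine Submodule.sum_mem _ fun u hu => ?_
    have hu' : (u.sum fun _ k => k) < N := lt_of_le_of_lt (le_totalDegree hu) hprod_deg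
    rw [hsmul]
    exact Submodule.smul_mem _ _ (ih _ hu' u rfl)
  have htop : S = ⊤ := by
    refine Submodule.eq_top_iff'.2 fun q => ?_
    obtain ⟨p, rfl⟩ := Ideal.Quotient.mk_surjective q
    change mk p ∈ S
    rw [p.as_sum, map_sum]
    refine Submodule.sum_mem _ fun u _ => ?_
    rw [hsmul]
    exact Submodule.smul_mem _ _ (key u)
  refine Module.finite_def.2 ?_
  rw [← htop]
  exact Submodule.fg_span (Finset.finite_toSet _)

/-- **The width lemma at the origin** (Kumar–Volk 2022 Lemma 4 = [CKSV19, K19], for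
constant-free `P_j, Q_j`, i.e. common zero `0`): if `Σ_i x_i^d = Σ_j P_j Q_j + P'` with
`deg P' < d` and all `P_j, Q_j` without constant term, then `n ≤ 2 t`. Proof ([CKSV19]):
differentiate — `d x_i^{d−1} − ∂_i P' ∈ I = (P_j, Q_j)`; so `K[x]/I` is a quotient of
`K[x]/(x_i^{d−1} − d⁻¹ ∂_i P')`, which is finite-dimensional (monomial reduction); a minimal
prime of `I` inside `𝔪₀` is then maximal, hence `= 𝔪₀` of height `n`, while Krull's height
theorem bounds its height by the `2t` generators. Any field with `(d : K) ≠ 0`.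
[cite: KumarVolk2022b, Lemma 4] -/
theorem width_lemma_zero {d : ℕ} (hd : 2 ≤ d) (hdK : (d : K) ≠ 0) {ι : Type*} [Fintype ι]
    (P Q : ι → MvPolynomial (Fin n) K) (hP : ∀ j, constantCoeff (P j) = 0)
    (hQ : ∀ j, constantCoeff (Q j) = 0) (P' : MvPolynomial (Fin n) K)
    (hP' : P'.totalDegree < d) (h : psum (Fin n) K d = ∑ j, P j * Q j + P') :
    n ≤ 2 * Fintype.card ι := by
  classical
  -- the ideal `I = (P_j, Q_j : j)` and the maximal ideal of the origin
  let s : Finset (MvPolynomial (Fin n) K) := Finset.univ.image P ∪ Finset.univ.image Q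
  let I : Ideal (MvPolynomial (Fin n) K) := Ideal.span (s : Set _)
  set 𝔪 : Ideal (MvPolynomial (Fin n) K) :=
    RingHom.ker (constantCoeff : MvPolynomial (Fin n) K →+* K) with h𝔪
  haveI h𝔪max : 𝔪.IsMaximal :=
    RingHom.ker_isMaximal_of_surjective _ fun c => ⟨C c, constantCoeff_C _ c⟩
  have hscard : s.card ≤ 2 * Fintype.card ι := by
    refine (Finset.card_union_le _ _).trans ?_
    have h1 := Finset.card_image_le (s := Finset.univ) (f := P)
    have h2 := Finset.card_image_le (s := Finset.univ) (f := Q)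
    rw [Finset.card_univ] at h1 h2
    omega
  have hPI : ∀ j, P j ∈ I := fun j => Ideal.subset_span (Finset.mem_coe.2
    (Finset.mem_union_left _ (Finset.mem_image_of_mem _ (Finset.mem_univ j))))
  have hQI : ∀ j, Q j ∈ I := fun j => Ideal.subset_span (Finset.mem_coe.2
    (Finset.mem_union_right _ (Finset.mem_image_of_mem _ (Finset.mem_univ j))))
  have hI𝔪 : I ≤ 𝔪 := by
    rw [Ideal.span_le]
    intro g hg
    rw [SetLike.mem_coe, h𝔪, RingHom.mem_ker]
    rcases Finset.mem_union.1 (Finset.mem_coe.1 hg) with hg | hg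
    · obtain ⟨j, -, rfl⟩ := Finset.mem_image.1 hg; exact hP j
    · obtain ⟨j, -, rfl⟩ := Finset.mem_image.1 hg; exact hQ j
  -- differentiate: `x_i^{d-1} - h_i ∈ I` with `h_i = d⁻¹ ∂_i P'`
  let hh : Fin n → MvPolynomial (Fin n) K := fun i => C (d : K)⁻¹ * pderiv i P'
  have hhdeg : ∀ i, (hh i).totalDegree ≤ d - 2 := fun i =>
    (totalDegree_C_mul_le _ _).trans ((totalDegree_pderiv_le i P').trans (by omega))
  have hmem : ∀ i, X i ^ (d - 2 + 1) - hh i ∈ I := by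
    intro i
    have hd1 : d - 2 + 1 = d - 1 := by omega
    rw [hd1]
    have hderiv := congrArg (pderiv i) h
    rw [pderiv_psum, map_add, map_sum] at hderiv
    -- `∂_i (Σ P_j Q_j) ∈ I`
    have hsumI : ∑ j, pderiv i (P j * Q j) ∈ I := by
      refine Ideal.sum_mem _ fun j _ => ?_
      rw [Derivation.leibniz, smul_eq_mul, smul_eq_mul]
      exact Ideal.add_mem _ (Ideal.mul_mem_right _ _ (hPI j)) (Ideal.mul_mem_right _ _ (hQI j))
    have hdC : (d : MvPolynomial (Fin n) K) = C (d : K) := (map_natCast C d).symm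
    have : X i ^ (d - 1) - hh i =
        C (d : K)⁻¹ * ((d : MvPolynomial (Fin n) K) * X i ^ (d - 1) - pderiv i P') := by
      simp only [hh, hdC, mul_sub, ← mul_assoc, ← C_mul, inv_mul_cancel₀ hdK, C_1, one_mul]
    rw [this, hderiv, add_sub_cancel_right]
    exact Ideal.mul_mem_left _ _ hsumI
  -- hence the quotient by `I` (indeed by the smaller `J`) is finite over `K`
  let J : Ideal (MvPolynomial (Fin n) K) := Ideal.span (Set.range fun i => X i ^ (d - 2 + 1) - hh i)
  have hJI : J ≤ I := by
    rw [Ideal.span_le]; rintro _ ⟨i, rfl⟩; exact hmem i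
  haveI hJfin : Module.Finite K (MvPolynomial (Fin n) K ⧸ J) :=
    moduleFinite_quotient_of_pow_sub_mem J hh hhdeg fun i => Ideal.subset_span ⟨i, rfl⟩
  -- a minimal prime of `I` below `𝔪`
  obtain ⟨𝔭, h𝔭min, h𝔭𝔪⟩ := Ideal.exists_minimalPrimes_le hI𝔪
  haveI h𝔭prime : 𝔭.IsPrime := h𝔭min.1.1
  have hJ𝔭 : J ≤ 𝔭 := hJI.trans h𝔭min.1.2
  -- `K[x]/𝔭` is a finite-dimensional domain, hence a field: `𝔭` is maximal
  haveI : Module.Finite K (MvPolynomial (Fin n) K ⧸ 𝔭) :=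
    Module.Finite.of_surjective (Ideal.Quotient.factorₐ K hJ𝔭).toLinearMap
      (Ideal.Quotient.factor_surjective hJ𝔭)
  have h𝔭max : 𝔭.IsMaximal := by
    refine Ideal.Quotient.maximal_of_isField _ ?_
    haveI : Algebra.IsIntegral K (MvPolynomial (Fin n) K ⧸ 𝔭) := Algebra.IsIntegral.of_finite K _
    exact isField_of_isIntegral_of_isField' (Field.toIsField K)
  have h𝔭eq : 𝔭 = 𝔪 := h𝔭max.eq_of_le h𝔪max.ne_top h𝔭𝔪
  -- heights: `n = height 𝔪 = height 𝔭 ≤ #generators ≤ 2t`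
  have hKrull : 𝔭.height ≤ s.card := Ideal.height_le_card_of_mem_minimalPrimes_span_finset h𝔭min
  have hn : 𝔪.height = n := by
    rw [h𝔪]; exact Literature.RingTheory.KrullDimension.height_ker_constantCoeff n
  rw [h𝔭eq, hn] at hKrull
  have hfin : ((n : ℕ) : ℕ∞) ≤ ((2 * Fintype.card ι : ℕ) : ℕ∞) :=
    hKrull.trans (by exact_mod_cast hscard)
  exact_mod_cast hfin

end Width

/-! ### The power sum -/

section Psum

variable {K : Type*} [Field K] {n : ℕ}

/-- `Σ x_i^d` has no constant term (`d ≥ 1`). [folklore] -/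
private theorem constantCoeff_psum {d : ℕ} (hd : d ≠ 0) : constantCoeff (psum (Fin n) K d) = 0 := by
  simp only [psum, map_sum, map_pow, constantCoeff_X, zero_pow hd, Finset.sum_const_zero]

/-- `Σ x_i^d` is homogeneous of degree `d` (Kumar–Volk §1.3, p0003: "it is also a polynomial
of degree `n`"). [cite: KumarVolk2022b, §1.3] -/
theorem psum_isHomogeneous (d : ℕ) : (psum (Fin n) K d).IsHomogeneous d := by
  simp only [psum]
  exact IsHomogeneous.sum _ _ _ fun i _ => isHomogeneous_X_pow i d

/-- The coefficient of `x_i^d` in `Σ_j x_j^d` is `1` (`d ≥ 1`). [folklore] -/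
private theorem coeff_psum_single {d : ℕ} (hd : d ≠ 0) (i : Fin n) :
    coeff (Finsupp.single i d) (psum (Fin n) K d) = 1 := by
  classical
  simp only [psum, coeff_sum, coeff_X_pow]
  rw [Finset.sum_eq_single i]
  · simp
  · intro j _ hji
    rw [if_neg]
    intro h
    have := Finsupp.single_eq_single_iff _ _ _ _ |>.1 h
    omega
  · intro h; exact absurd (Finset.mem_univ i) h

/-- `deg (Σ_{i<n} x_i^d) = d` for `n ≥ 1`, `d ≥ 1` (Kumar–Volk §1.3, p0003: "it is also a
polynomial of degree `n`, so its determinantal complexity is at least … `n`").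
[cite: KumarVolk2022b, §1.3] -/
theorem totalDegree_psum {d : ℕ} (hn : 1 ≤ n) (hd : d ≠ 0) :
    (psum (Fin n) K d).totalDegree = d := by
  refine (psum_isHomogeneous d).totalDegree ?_
  intro h
  have := coeff_psum_single (K := K) hd (⟨0, hn⟩ : Fin n)
  rw [h, coeff_zero] at this
  exact zero_ne_one this

end Psum

/-! ### Lemma 11: the lower bound for higher-degree polynomial maps in normal form -/

section Lemma11

variable {K : Type*} [Field K] {n : ℕ}

/-- In normal form, the first row has no constant terms. [cite: KumarVolk2022b, Lemma 11 (proof)] -/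
theorem IsNormalForm.constantCoeff_row_zero {m : ℕ}
    {M : Matrix (Fin (m + 1)) (Fin (m + 1)) (MvPolynomial (Fin n) K)} (hnf : IsNormalForm M)
    (j : Fin (m + 1)) : constantCoeff (M 0 j) = 0 := by
  rw [hnf]; simp

/-- In normal form, the minor `N_{1,1}` has constant part the identity, so `det N_{1,1}` has
constant term `1` (p0007: "`N_{1,1}(0)` is the `(m−1) × (m−1)` identity matrix, so the constant
term of `det(N_{1,1})` is `1`"). [cite: KumarVolk2022b, Lemma 11 (proof)] -/
theorem IsNormalForm.constantCoeff_det_minor_zero {m : ℕ}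
    {M : Matrix (Fin (m + 1)) (Fin (m + 1)) (MvPolynomial (Fin n) K)} (hnf : IsNormalForm M) :
    constantCoeff (M.submatrix Fin.succ (Fin.succAbove 0)).det = 1 := by
  rw [← det_constPart]
  have : constPart (M.submatrix Fin.succ (Fin.succAbove 0)) = 1 := by
    ext i k
    rw [constPart_apply, submatrix_apply, Fin.succAbove_zero, hnf, Matrix.one_apply]
    simp [Fin.succ_inj]
  rw [this, det_one]

/-- In normal form, every other first-row minor `N_{1,j}`, `j ≠ 1`, has a constant part with a
zero column, so `det N_{1,j}` is constant free (p0007: "`N_{1,j}(0)` … has at most `m − 2`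
non-zero entries … `det(N_{1,j})(0) = 0`"). [cite: KumarVolk2022b, Lemma 11 (proof)] -/
theorem IsNormalForm.constantCoeff_det_minor_ne_zero {m : ℕ}
    {M : Matrix (Fin (m + 1)) (Fin (m + 1)) (MvPolynomial (Fin n) K)} (hnf : IsNormalForm M)
    {j : Fin (m + 1)} (hj : j ≠ 0) :
    constantCoeff (M.submatrix Fin.succ j.succAbove).det = 0 := by
  cases m with
  | zero => exact absurd (Fin.eq_zero j) hj
  | succ m =>
    rw [← det_constPart]
    refine det_eq_zero_of_column_eq_zero 0 fun i => ?_
    rw [constPart_apply, submatrix_apply, Fin.succAbove_ne_zero_zero hj, hnf]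
    simp [Fin.succ_ne_zero]

/-- **Kumar–Volk 2022, Lemma 11**, over any field with `(d : K) ≠ 0`: if `M` is an `m × m`
matrix of polynomials of degree `≤ d − 1` in normal form with `det M = (Σ x_i^d)·(β + Q)`,
`β ≠ 0`, `Q(0) = 0`, then `m ≥ n/2 − 1`, i.e. `n ≤ 2m + 2`. Printed proof (p0007): Laplace
expansion along the first row, `det M = Σ_j (−1)^{1+j} M_{1,j} det N_{1,j}`; `det N_{1,1} = 1 + P`
and `det N_{1,j}` (`j ≠ 1`) are handled by the two lemmas above; rearranging,
`Σ x_i^d = β⁻¹( −(Σ x_i^d) Q + M_{1,1} P + Σ_{j ≥ 2} ± M_{1,j} det N_{1,j}) + β⁻¹ M_{1,1}` is a sum of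
`m + 1` products of constant-free polynomials plus a polynomial of degree `< d`, and the width
lemma (Lemma 4 at the origin, `width_lemma_zero`) gives `m + 1 ≥ n/2`.
[cite: KumarVolk2022b, Lemma 11] -/
theorem lemma_11_general {d : ℕ} (hd : 2 ≤ d) (hdK : (d : K) ≠ 0) {m : ℕ}
    (M : Matrix (Fin m) (Fin m) (MvPolynomial (Fin n) K)) (hdeg : polyDeg M ≤ d - 1)
    (hnf : IsNormalForm M) (β : K) (Q : MvPolynomial (Fin n) K) (hβ : β ≠ 0)
    (hQ : constantCoeff Q = 0) (hdet : M.det = psum (Fin n) K d * (C β + Q)) :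
    n ≤ 2 * m + 2 := by
  classical
  cases m with
  | zero =>
    -- `det M = 1` has constant term `1`, but `(Σ x_i^d)(β + Q)` has constant term `0`
    exfalso
    have h := congrArg constantCoeff hdet
    rw [Matrix.det_isEmpty, map_one, map_mul, constantCoeff_psum (by omega), zero_mul] at h
    exact one_ne_zero h
  | succ m =>
    set F : MvPolynomial (Fin n) K := psum (Fin n) K d with hF
    -- Laplace expansion along the first row
    have hL := Matrix.det_succ_row_zero M
    set Nm : Fin (m + 1) → Matrix (Fin m) (Fin m) (MvPolynomial (Fin n) K) :=
      fun j => M.submatrix Fin.succ j.succAbove with hNm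
    set c : Fin (m + 1) → K := fun j => constantCoeff (Nm j).det with hc
    have hc' : ∀ j, c j = if j = 0 then 1 else 0 := by
      intro j
      split_ifs with hj
      · subst hj; exact hnf.constantCoeff_det_minor_zero
      · exact hnf.constantCoeff_det_minor_ne_zero hj
    have hsumc : ∑ j : Fin (m + 1), (-1 : MvPolynomial (Fin n) K) ^ (j : ℕ) * M 0 j * C (c j) =
        M 0 0 := by
      rw [Finset.sum_eq_single (0 : Fin (m + 1))]
      · rw [hc', if_pos rfl, C_1, mul_one, Fin.val_zero, pow_zero, one_mul]
      · intro j _ hj; rw [hc', if_neg hj, C_0, mul_zero]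
      · intro h; exact absurd (Finset.mem_univ _) h
    have hββ : C (β⁻¹ : K) * (C β : MvPolynomial (Fin n) K) = 1 := by
      rw [← C_mul, inv_mul_cancel₀ hβ, C_1]
    -- the `m + 2` products of constant-free polynomials
    let P : Option (Fin (m + 1)) → MvPolynomial (Fin n) K := fun o =>
      o.elim F fun j => C (β⁻¹ : K) * ((-1) ^ (j : ℕ) * M 0 j)
    let Qq : Option (Fin (m + 1)) → MvPolynomial (Fin n) K := fun o =>
      o.elim (-(C (β⁻¹ : K) * Q)) fun j => (Nm j).det - C (c j)
    have hS : ∑ j : Fin (m + 1), P (some j) * Qq (some j) =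
        C (β⁻¹ : K) * M.det - C (β⁻¹ : K) * M 0 0 := by
      rw [hL, ← hsumc, Finset.mul_sum, Finset.mul_sum, ← Finset.sum_sub_distrib]
      refine Finset.sum_congr rfl fun j _ => ?_
      simp only [P, Qq, Option.elim, hNm]
      ring
    have hid : F = ∑ o, P o * Qq o + C (β⁻¹ : K) * M 0 0 := by
      rw [Fintype.sum_option, hS]
      simp only [P, Qq, Option.elim]
      linear_combination (-C (β⁻¹ : K)) * hdet + (-F) * hββ
    have hP0 : ∀ o, constantCoeff (P o) = 0 := by
      intro o
      cases o with
      | none => exact constantCoeff_psum (by omega)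
      | some j =>
        simp only [P, Option.elim, map_mul, hnf.constantCoeff_row_zero j, mul_zero]
    have hQ0 : ∀ o, constantCoeff (Qq o) = 0 := by
      intro o
      cases o with
      | none => simp only [Qq, Option.elim, map_neg, map_mul, hQ, mul_zero, neg_zero]
      | some j => simp only [Qq, Option.elim, map_sub, constantCoeff_C, hc, sub_self]
    have hP'deg : (C (β⁻¹ : K) * M 0 0).totalDegree < d := by
      refine lt_of_le_of_lt (totalDegree_C_mul_le _ _) ?_
      exact lt_of_le_of_lt ((totalDegree_le_polyDeg M 0 0).trans hdeg) (by omega)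
    have hw := width_lemma_zero hd hdK P Qq hP0 hQ0 _ hP'deg hid
    rw [Fintype.card_option, Fintype.card_fin] at hw
    omega

end Lemma11

/-! ### Lemma 4 with an arbitrary common zero (translation to the origin) -/

section WidthGeneral

variable {K : Type*} [Field K] {n : ℕ}

/-- Translating `Σ x_i^d` changes it by a polynomial of degree `< d`:
`Σ (x_i + a_i)^d − Σ x_i^d` has degree `≤ d − 1`. [folklore] -/
private theorem totalDegree_transl_psum_sub_lt {d : ℕ} (hd : d ≠ 0) (a : Fin n → K) :
    (transl a (psum (Fin n) K d) - psum (Fin n) K d).totalDegree < d := by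
  have hterm : ∀ i : Fin n,
      ((X i + C (a i)) ^ d - X i ^ d : MvPolynomial (Fin n) K).totalDegree < d := by
    intro i
    rw [add_pow, Finset.sum_range_succ, Nat.choose_self, Nat.cast_one, mul_one, Nat.sub_self,
      pow_zero, mul_one, add_sub_cancel_right]
    refine lt_of_le_of_lt (totalDegree_finsetSum_le (d := d - 1) fun k hk => ?_) (by omega)
    rw [Finset.mem_range] at hk
    calc (X i ^ k * C (a i) ^ (d - k) * (d.choose k : MvPolynomial (Fin n) K)).totalDegree
        ≤ (X i ^ k * C (a i) ^ (d - k)).totalDegree +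
            (d.choose k : MvPolynomial (Fin n) K).totalDegree := totalDegree_mul _ _
      _ ≤ ((X i ^ k : MvPolynomial (Fin n) K).totalDegree +
            (C (a i) ^ (d - k) : MvPolynomial (Fin n) K).totalDegree) + 0 := by
          refine add_le_add (totalDegree_mul _ _) (le_of_eq ?_)
          rw [← map_natCast (C : K →+* MvPolynomial (Fin n) K), totalDegree_C]
      _ ≤ (k * 1 + 0) + 0 := by
          refine add_le_add (add_le_add ?_ (le_of_eq ?_)) le_rfl
          · exact (totalDegree_pow _ _).trans (Nat.mul_le_mul_left _ (isHomogeneous_X K i).totalDegree_le)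
          · rw [← map_pow, totalDegree_C]
      _ ≤ d - 1 := by omega
  have hsum : transl a (psum (Fin n) K d) - psum (Fin n) K d =
      ∑ i : Fin n, ((X i + C (a i)) ^ d - X i ^ d) := by
    simp only [psum, map_sum, map_pow, transl_X, Finset.sum_sub_distrib]
  rw [hsum]
  exact lt_of_le_of_lt (totalDegree_finsetSum_le fun i _ => Nat.le_sub_one_of_lt (hterm i))
    (by omega)

/-- A translation does not raise the total degree. [folklore] -/
private theorem totalDegree_transl_le (a : Fin n → K) (p : MvPolynomial (Fin n) K) :
    (transl a p).totalDegree ≤ p.totalDegree :=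
  HasDetRepr.totalDegree_aeval_le_of_le_one _ (fun i =>
    (totalDegree_add _ _).trans (max_le (isHomogeneous_X K i).totalDegree_le
      (by rw [totalDegree_C]; exact Nat.zero_le _))) p

/-- **Kumar–Volk 2022, Lemma 4** ([CKSV19, K19]) over any field with `(d : K) ≠ 0` and with an
arbitrary common zero `a`: translate to the origin (`transl a`), which moves `Σ x_i^d` by a
polynomial of degree `< d` and turns "vanishes at `a`" into "constant free", then
`width_lemma_zero`. [cite: KumarVolk2022b, Lemma 4] -/
theorem width_lemma {d : ℕ} (hd : 2 ≤ d) (hdK : (d : K) ≠ 0) {ι : Type*} [Fintype ι]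
    (P Q : ι → MvPolynomial (Fin n) K) (P' : MvPolynomial (Fin n) K) (hP' : P'.totalDegree < d)
    (a : Fin n → K) (ha : ∀ j, MvPolynomial.eval a (P j) = 0 ∧ MvPolynomial.eval a (Q j) = 0)
    (h : psum (Fin n) K d = ∑ j, P j * Q j + P') : n ≤ 2 * Fintype.card ι := by
  have h' := congrArg (transl a) h
  rw [map_add, map_sum] at h'
  simp only [map_mul] at h'
  have hid : psum (Fin n) K d = ∑ j, transl a (P j) * transl a (Q j) +
      (transl a P' - (transl a (psum (Fin n) K d) - psum (Fin n) K d)) := by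
    rw [h']; ring
  refine width_lemma_zero hd hdK (fun j => transl a (P j)) (fun j => transl a (Q j))
    (fun j => ?_) (fun j => ?_) _ ?_ hid
  · rw [constantCoeff_transl]; exact (ha j).1
  · rw [constantCoeff_transl]; exact (ha j).2
  · exact lt_of_le_of_lt (totalDegree_sub _ _) (max_lt (lt_of_le_of_lt (totalDegree_transl_le a P') hP')
      (totalDegree_transl_psum_sub_lt (by omega) a))

end WidthGeneral

/-! ### Lemma 5: the normal form (for `n > 4`) -/

section NormalForm

variable {K : Type*} [Field K] {n : ℕ}

/-- Left multiplication by a constant matrix does not raise `deg M` (Kumar–Volk, proof of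
Lemma 5, p0006: "Since `G₁, G₂, Δ ∈ 𝔽^{m×m}` … `deg M̃ ≤ deg M`"). [cite: KumarVolk2022b, Lemma 5 (proof)] -/
theorem polyDeg_constMul_le {m : ℕ} (A : Matrix (Fin m) (Fin m) K)
    (M : Matrix (Fin m) (Fin m) (MvPolynomial (Fin n) K)) :
    polyDeg (A.map (C : K → MvPolynomial (Fin n) K) * M) ≤ polyDeg M := by
  rw [polyDeg_le_iff]
  intro i j
  rw [Matrix.mul_apply]
  refine totalDegree_finsetSum_le fun l _ => ?_
  rw [Matrix.map_apply]
  exact (totalDegree_C_mul_le _ _).trans (totalDegree_le_polyDeg M l j)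

/-- Right multiplication by a constant matrix does not raise `deg M` (Kumar–Volk, proof of
Lemma 5, p0006). [cite: KumarVolk2022b, Lemma 5 (proof)] -/
theorem polyDeg_mulConst_le {m : ℕ} (M : Matrix (Fin m) (Fin m) (MvPolynomial (Fin n) K))
    (A : Matrix (Fin m) (Fin m) K) :
    polyDeg (M * A.map (C : K → MvPolynomial (Fin n) K)) ≤ polyDeg M := by
  rw [polyDeg_le_iff]
  intro i j
  rw [Matrix.mul_apply]
  refine totalDegree_finsetSum_le fun l _ => ?_
  rw [Matrix.map_apply, mul_comm]
  exact (totalDegree_C_mul_le _ _).trans (totalDegree_le_polyDeg M i l)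

/-- Reindexing (a submatrix on the same entries) does not raise `deg M` (used for the row/column
permutation in the proof of Lemma 5). [cite: KumarVolk2022b, Lemma 5 (proof)] -/
theorem polyDeg_submatrix_le {m m' : ℕ} (M : Matrix (Fin m) (Fin m) (MvPolynomial (Fin n) K))
    (e f : Fin m' → Fin m) : polyDeg (M.submatrix e f) ≤ polyDeg M := by
  rw [polyDeg_le_iff]
  intro i j
  rw [Matrix.submatrix_apply]
  exact totalDegree_le_polyDeg M _ _

/-- **Kumar–Volk 2022, Lemma 5** (normal form), over any field with `(d : K) ≠ 0`, for `n > 4`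
(the range in which the printed proof applies; cf. the erratum note in the statement file): a
polynomial matrix with `det M = Σ x_i^d` can be replaced by one of no larger degree, the same
determinant, and constant part `diag(0, 1, …, 1)`. Printed proof (p0006): `rank M(0) = m − 1`
by Lemma 8 + Fact 9 (tree: `alperBogartVelasco2017_prop_2_1_rank_zero`), then Gaussian
elimination `G₁ M₀ G₂ = diag(0, *, …, *)` and a diagonal rescaling `Δ` with
`det G₁ · det G₂ · det Δ = 1` (tree: `exists_mul_mul_eq_lamMatrix` gives `V M(0) U = Λ_{i₀}`; we
rescale the `i₀`-th column by `(det V det U)⁻¹`, which `Λ_{i₀}` does not see, and conjugate by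
the transposition `(1 i₀)` to put the zero at position `(1,1)`). [cite: KumarVolk2022b, Lemma 5] -/
theorem lemma_5_general {d : ℕ} (hd : 2 ≤ d) (hdK : (d : K) ≠ 0) (hn : 4 < n) {m : ℕ}
    (M : Matrix (Fin m) (Fin m) (MvPolynomial (Fin n) K)) (hdet : M.det = psum (Fin n) K d) :
    ∃ M' : Matrix (Fin m) (Fin m) (MvPolynomial (Fin n) K),
      polyDeg M' ≤ polyDeg M ∧ M'.det = psum (Fin n) K d ∧ IsNormalForm M' := by
  classical
  cases m with
  | zero =>
    exfalso
    have h := congrArg constantCoeff hdet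
    rw [Matrix.det_isEmpty, map_one, constantCoeff_psum (by omega)] at h
    exact one_ne_zero h
  | succ m =>
    set F : MvPolynomial (Fin n) K := psum (Fin n) K d with hF
    have h4 : 4 < (singIdeal F).height := by
      rw [hF, kumarVolk2022_fact_9 hd hdK]; exact_mod_cast hn
    have hrank := alperBogartVelasco2017_prop_2_1_rank_zero (psum_isHomogeneous d) (by omega) h4
      M hdet
    obtain ⟨V, U, i₀, hV, hU, hVU⟩ := exists_mul_mul_eq_lamMatrix (constPart M)
      (by rw [Fintype.card_fin]; omega) (by rw [Fintype.card_fin]; omega)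
    -- determinant correction on the `i₀`-th column
    have hVdet : V.det ≠ 0 := ((Matrix.isUnit_iff_isUnit_det V).1 hV).ne_zero
    have hUdet : U.det ≠ 0 := ((Matrix.isUnit_iff_isUnit_det U).1 hU).ne_zero
    set c : K := (V.det * U.det)⁻¹ with hc
    have hcVU : V.det * U.det * c = 1 := mul_inv_cancel₀ (mul_ne_zero hVdet hUdet)
    let δ : Fin (m + 1) → K := Function.update 1 i₀ c
    let Δ : Matrix (Fin (m + 1)) (Fin (m + 1)) K := Matrix.diagonal δ
    have hΔdet : Δ.det = c := by
      rw [Matrix.det_diagonal, Finset.prod_update_of_mem (Finset.mem_univ _)]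
      simp
    have hΛΔ : lamMatrix K i₀ * Δ = lamMatrix K i₀ := by
      rw [lamMatrix, Matrix.diagonal_mul_diagonal]
      congr 1
      funext i
      by_cases hi : i = i₀
      · subst hi; simp
      · simp [δ, Function.update_of_ne hi]
    -- the corrected matrix `M₁ = V M U Δ`
    let Cm : Matrix (Fin (m + 1)) (Fin (m + 1)) K → Matrix (Fin (m + 1)) (Fin (m + 1))
        (MvPolynomial (Fin n) K) := fun A => A.map (C : K → MvPolynomial (Fin n) K)
    have hCdet : ∀ A : Matrix (Fin (m + 1)) (Fin (m + 1)) K, (Cm A).det = C A.det := by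
      intro A
      change ((C : K →+* MvPolynomial (Fin n) K).mapMatrix A).det = _
      rw [← RingHom.map_det]
    let M₁ := Cm V * M * Cm U * Cm Δ
    have hM₁det : M₁.det = F := by
      simp only [M₁, Matrix.det_mul, hCdet, hdet, hΔdet]
      calc C V.det * F * C U.det * C c = F * C (V.det * U.det * c) := by simp only [C_mul]; ring
        _ = F := by rw [hcVU, C_1, mul_one]
    have hM₁const : constPart M₁ = lamMatrix K i₀ := by
      simp only [M₁, Cm, constPart_mul, constPart_map_C, hVU, hΛΔ]
    have hM₁deg : polyDeg M₁ ≤ polyDeg M :=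
      (polyDeg_mulConst_le _ _).trans ((polyDeg_mulConst_le _ _).trans (polyDeg_constMul_le _ _))
    -- conjugate by the transposition `(0 i₀)`
    let σ : Equiv.Perm (Fin (m + 1)) := Equiv.swap 0 i₀
    refine ⟨M₁.submatrix σ σ, (polyDeg_submatrix_le _ _ _).trans hM₁deg,
      by rw [Matrix.det_submatrix_equiv_self, hM₁det], ?_⟩
    rw [isNormalForm_iff_constPart]
    have : constPart (M₁.submatrix σ σ) = (constPart M₁).submatrix σ σ := rfl
    rw [this, hM₁const]
    ext i j
    simp only [Matrix.submatrix_apply, lamMatrix_apply, EmbeddingLike.apply_eq_iff_eq]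
    have hσ : σ i = i₀ ↔ i = 0 := by
      rw [Equiv.apply_eq_iff_eq_symm_apply, Equiv.symm_swap, Equiv.swap_apply_right]
    simp only [hσ]

end NormalForm

/-! ### Theorem 1: trading the lower-right block for degree (§3.3) -/

section MainTheorem

variable {K : Type*} [Field K]

/-- Entries of the adjugate of an `(s+1) × (s+1)` matrix of polynomials of degree `≤ e` have
degree `≤ s e` (they are signed `s × s` minors; Kumar–Volk §3.3, p0007: "the entries of `D⁻¹` can
be written as a ratio of two polynomials, where the numerator has degree at most `n − 3`").
[cite: KumarVolk2022b, Thm. 1 (proof, §3.3)] -/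
theorem totalDegree_adjugate_le {σ : Type*} {s : ℕ}
    (D : Matrix (Fin (s + 1)) (Fin (s + 1)) (MvPolynomial σ K)) {e : ℕ}
    (hD : ∀ i j, (D i j).totalDegree ≤ e) (p l : Fin (s + 1)) :
    (D.adjugate p l).totalDegree ≤ s * e := by
  rw [Matrix.adjugate_fin_succ_eq_det_submatrix]
  refine (totalDegree_mul _ _).trans ?_
  have h1 : ((-1 : MvPolynomial σ K) ^ (l + p : ℕ)).totalDegree = 0 := by
    refine Nat.eq_zero_of_le_zero ((totalDegree_pow _ _).trans ?_)
    rw [totalDegree_neg, totalDegree_one, mul_zero]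
  have h2 := totalDegree_det_le (D.submatrix l.succAbove p.succAbove) (e := e) fun i j => hD _ _
  rw [Fintype.card_fin] at h2
  omega

/-- **The core of the proof of Thm. 1** (§3.3, p0007–p0008), over any field with
`(n : K) ≠ 0`, `n = s + 3 ≥ 3`: if `M` is an `m × m` matrix of polynomials of degree `≤ 1` in
normal form with `det M = Σ_{i<n} x_i^n` and `m ≥ n`, then `3n ≤ 2m + 6`. As printed: split off
the lower-right principal `(n−2) × (n−2)` block `D` (constant part the identity, so `det D = 1 + R`
is a non-zero-divisor), `M = [[A, B], [C, D]]`; the matrix `N = det D · A − B · adj D · C`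
(`= det D · (A − B D⁻¹ C)`, Lemma 10 cleared of denominators: `M · [[det D · 1, 0],
[−adj D · C, 1]] = [[N, B], [0, D]]`) has size `m − n + 2`, entries of degree `≤ n − 1`, is in
normal form, and `det N = (Σ x_i^n) · (det D)^{m−n+1} = (Σ x_i^n)(1 + Q)`; Lemma 11 gives
`m − n + 2 ≥ n/2 − 1`. [cite: KumarVolk2022b, Thm. 1 (proof, §3.3)] -/
theorem thm_1_core {s : ℕ} (hK : ((s + 3 : ℕ) : K) ≠ 0) {m : ℕ}
    (M : Matrix (Fin m) (Fin m) (MvPolynomial (Fin (s + 3)) K)) (hMdeg : polyDeg M ≤ 1)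
    (hMdet : M.det = psum (Fin (s + 3)) K (s + 3)) (hMnf : IsNormalForm M) (hm : s + 3 ≤ m) :
    3 * (s + 3) ≤ 2 * m + 6 := by
  classical
  obtain ⟨k, rfl⟩ : ∃ k, m = k + (s + 1) := ⟨m - (s + 1), by omega⟩
  have hk : 2 ≤ k := by omega
  set F : MvPolynomial (Fin (s + 3)) K := psum (Fin (s + 3)) K (s + 3) with hF
  -- block decomposition along `Fin k ⊕ Fin (s+1) ≃ Fin (k + (s+1))`
  let e : Fin k ⊕ Fin (s + 1) ≃ Fin (k + (s + 1)) := finSumFinEquiv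
  let Ms : Matrix (Fin k ⊕ Fin (s + 1)) (Fin k ⊕ Fin (s + 1)) (MvPolynomial (Fin (s + 3)) K) :=
    M.submatrix e e
  let A : Matrix (Fin k) (Fin k) (MvPolynomial (Fin (s + 3)) K) := Ms.toBlocks₁₁
  let B : Matrix (Fin k) (Fin (s + 1)) (MvPolynomial (Fin (s + 3)) K) := Ms.toBlocks₁₂
  let C' : Matrix (Fin (s + 1)) (Fin k) (MvPolynomial (Fin (s + 3)) K) := Ms.toBlocks₂₁
  let D : Matrix (Fin (s + 1)) (Fin (s + 1)) (MvPolynomial (Fin (s + 3)) K) := Ms.toBlocks₂₂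
  have hMs : Matrix.fromBlocks A B C' D = Ms := Matrix.fromBlocks_toBlocks Ms
  have hMsdet : Ms.det = F := by rw [Matrix.det_submatrix_equiv_self, hMdet]
  have he_inl : ∀ i : Fin k, ((e (Sum.inl i) : Fin (k + (s + 1))) : ℕ) = i := fun i => by
    simp [e, finSumFinEquiv_apply_left]
  have he_inr : ∀ i : Fin (s + 1), ((e (Sum.inr i) : Fin (k + (s + 1))) : ℕ) = k + i := fun i => by
    simp [e, finSumFinEquiv_apply_right]
  have hMs_cc : ∀ a b, constantCoeff (Ms a b) =
      if a = b ∧ ((e a : Fin (k + (s + 1))) : ℕ) ≠ 0 then 1 else 0 := by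
    intro a b
    change constantCoeff (M (e a) (e b)) = _
    rw [hMnf]
    simp only [EmbeddingLike.apply_eq_iff_eq]
  have hMs_deg : ∀ a b, (Ms a b).totalDegree ≤ 1 := fun a b =>
    (totalDegree_le_polyDeg M _ _).trans hMdeg
  -- constant parts of the blocks
  have hA : IsNormalForm A := by
    intro i j
    change constantCoeff (Ms (Sum.inl i) (Sum.inl j)) = _
    rw [hMs_cc]
    simp only [Sum.inl.injEq, he_inl]
  have hC0 : ∀ l j, constantCoeff (C' l j) = 0 := fun l j => by
    change constantCoeff (Ms (Sum.inr l) (Sum.inl j)) = 0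
    rw [hMs_cc]; simp
  have hDcp : constPart D = 1 := by
    ext i j
    rw [constPart_apply]
    change constantCoeff (Ms (Sum.inr i) (Sum.inr j)) = _
    rw [hMs_cc, Matrix.one_apply]
    have hne : ((e (Sum.inr i) : Fin (k + (s + 1))) : ℕ) ≠ 0 := by rw [he_inr]; omega
    by_cases hij : i = j
    · subst hij; rw [if_pos ⟨rfl, hne⟩, if_pos rfl]
    · rw [if_neg (fun h => hij (Sum.inr_injective h.1)), if_neg hij]
  have hDcc : constantCoeff D.det = 1 := by rw [← det_constPart, hDcp, Matrix.det_one]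
  have hD0 : D.det ≠ 0 := fun h => by rw [h, map_zero] at hDcc; exact zero_ne_one hDcc
  -- the matrix `N = det D · A − B adj(D) C` and the polynomial Schur identity
  let N : Matrix (Fin k) (Fin k) (MvPolynomial (Fin (s + 3)) K) := D.det • A - B * D.adjugate * C'
  have hblock : Matrix.fromBlocks A B C' D *
      Matrix.fromBlocks (D.det • (1 : Matrix (Fin k) (Fin k) (MvPolynomial (Fin (s + 3)) K))) 0
        (-(D.adjugate * C')) 1 = Matrix.fromBlocks N B 0 D := by
    rw [Matrix.fromBlocks_multiply, Matrix.fromBlocks_inj]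
    refine ⟨?_, ?_, ?_, ?_⟩
    · rw [Matrix.mul_smul, Matrix.mul_one, Matrix.mul_neg, ← Matrix.mul_assoc, ← sub_eq_add_neg]
    · rw [Matrix.mul_zero, zero_add, Matrix.mul_one]
    · rw [Matrix.mul_smul, Matrix.mul_one, Matrix.mul_neg, ← Matrix.mul_assoc, Matrix.mul_adjugate,
        Matrix.smul_mul, Matrix.one_mul, add_neg_cancel]
    · rw [Matrix.mul_zero, zero_add, Matrix.mul_one]
  have hdet_eq : F * D.det ^ k = N.det * D.det := by
    have h := congrArg Matrix.det hblock
    rwa [Matrix.det_mul, hMs, hMsdet, Matrix.det_fromBlocks_zero₁₂, Matrix.det_smul, Matrix.det_one,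
      mul_one, Fintype.card_fin, Matrix.det_one, mul_one, Matrix.det_fromBlocks_zero₂₁] at h
  obtain ⟨k', rfl⟩ : ∃ k', k = k' + 1 := ⟨k - 1, by omega⟩
  have hNdet : N.det = F * D.det ^ k' := by
    apply mul_right_cancel₀ hD0
    rw [← hdet_eq, pow_succ, mul_assoc]
  -- `N` is in normal form
  have hNnf : IsNormalForm N := by
    intro i j
    simp only [N, Matrix.sub_apply, Matrix.smul_apply, smul_eq_mul, map_sub, map_mul, hDcc, one_mul,
      Matrix.mul_apply, map_sum, hC0, mul_zero, Finset.sum_const_zero, sub_zero]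
    exact hA i j
  -- `deg N ≤ n − 1`
  have hNdeg : polyDeg N ≤ (s + 3) - 1 := by
    rw [polyDeg_le_iff]
    intro i j
    simp only [N, Matrix.sub_apply, Matrix.smul_apply, smul_eq_mul]
    refine (totalDegree_sub _ _).trans (max_le ?_ ?_)
    · refine (totalDegree_mul _ _).trans ?_
      have h1 := totalDegree_det_le D (e := 1) fun a b => hMs_deg _ _
      rw [Fintype.card_fin] at h1
      have h2 : (A i j).totalDegree ≤ 1 := hMs_deg _ _
      omega
    · rw [Matrix.mul_apply]
      refine totalDegree_finsetSum_le fun l _ => ?_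
      rw [Matrix.mul_apply, Finset.sum_mul]
      refine totalDegree_finsetSum_le fun p _ => ?_
      refine (totalDegree_mul _ _).trans ((add_le_add (totalDegree_mul _ _) le_rfl).trans ?_)
      have h1 : (B i p).totalDegree ≤ 1 := hMs_deg _ _
      have h2 := totalDegree_adjugate_le D (e := 1) (fun a b => hMs_deg _ _) p l
      have h3 : (C' l j).totalDegree ≤ 1 := hMs_deg _ _
      omega
  -- `det N = F · (1 + Q)` with `Q = (det D)^{k'} − 1` constant free; Lemma 11
  have hQ : constantCoeff (D.det ^ k' - 1 : MvPolynomial (Fin (s + 3)) K) = 0 := by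
    rw [map_sub, map_pow, hDcc, one_pow, map_one, sub_self]
  have hNdet' : N.det = psum (Fin (s + 3)) K (s + 3) * (C (1 : K) + (D.det ^ k' - 1)) := by
    rw [hNdet, hF, C_1, add_sub_cancel]
  have h11 := lemma_11_general (n := s + 3) (d := s + 3) (by omega) hK N hNdeg hNnf 1
    (D.det ^ k' - 1) one_ne_zero hQ hNdet'
  omega

/-- **Kumar–Volk 2022, Theorem 1, over any field** whose characteristic does not divide `n`
(the source's §1.3 remark "all the results in this paper also hold for algebraically closed
fields of positive characteristic `p`, as long as `p` doesn't divide `n`"; algebraic closure is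
not needed by the proof), and for every `n ≥ 5` (at `n = 5` the bound is the trivial `dc ≥ n`):
`dc(Σ_{i<n} x_i^n) ≥ 1.5 n − 3`, i.e. `3n ≤ 2 dc + 6`. Printed proof (§3.3): Lemma 5 on an optimal
affine representation (tree: `hasDetRepr_determinantalComplexity_holds`), `m ≥ n` by degrees
(`totalDegree_le_of_hasDetRepr_holds`), then `thm_1_core`. [cite: KumarVolk2022b, Thm. 1 and §1.3] -/
theorem thm_1_general (K : Type*) [Field K] {n : ℕ} (hn : 4 < n) (hnK : (n : K) ≠ 0) :
    3 * n ≤ 2 * determinantalComplexity (psum (Fin n) K n) + 6 := by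
  classical
  obtain ⟨s, rfl⟩ : ∃ s, n = s + 3 := ⟨n - 3, by omega⟩
  obtain ⟨A, hA⟩ := (hasDetRepr_determinantalComplexity_holds (psum (Fin (s + 3)) K (s + 3)) :
    HasDetRepr (psum (Fin (s + 3)) K (s + 3)) (determinantalComplexity (psum (Fin (s + 3)) K (s + 3))))
  have hdeg : (psum (Fin (s + 3)) K (s + 3)).totalDegree = s + 3 :=
    totalDegree_psum (by omega) (by omega)
  have hmn : s + 3 ≤ determinantalComplexity (psum (Fin (s + 3)) K (s + 3)) := by
    have h : (psum (Fin (s + 3)) K (s + 3)).totalDegree ≤ _ := totalDegree_le_of_hasDetRepr_holds ⟨A, hA⟩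
    rwa [hdeg] at h
  obtain ⟨M, hMdeg, hMdet, hMnf⟩ := lemma_5_general (d := s + 3) (by omega) hnK (by omega) A hA.2
  exact thm_1_core hnK M (hMdeg.trans ((polyDeg_le_iff A 1).2 hA.1)) hMdet hMnf hmn

end MainTheorem

end KumarVolk

/-! ### Discharges of the named facts of `KV22PowerSumDeterminantalComplexity.lean` -/

/-- **Discharge of `kumarVolk2022_lemma_4`** (Kumar–Volk 2022, Lemma 4 = [CKSV19, K19] width
lemma), by `KumarVolk.width_lemma` (which holds over every field with `(d : K) ≠ 0`).
[cite: KumarVolk2022b, Lemma 4] -/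
theorem kumarVolk2022_lemma_4_holds : kumarVolk2022_lemma_4 := by
  intro K _ _ n d hd hdK t P Q P' hP' ha h
  obtain ⟨a, ha⟩ := ha
  have hw := KumarVolk.width_lemma hd hdK P Q P' hP' a ha h
  rwa [Fintype.card_fin] at hw

/-- **Discharge of `kumarVolk2022_lemma_5`** (Kumar–Volk 2022, Lemma 5, normal form, with the
`n > 4` guard), by `KumarVolk.lemma_5_general`. [cite: KumarVolk2022b, Lemma 5] -/
theorem kumarVolk2022_lemma_5_holds : kumarVolk2022_lemma_5 := by
  intro K _ _ n d hd hdK hn m M hdet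
  exact KumarVolk.lemma_5_general hd hdK hn M hdet

/-- **Discharge of `kumarVolk2022_lemma_11`** (Kumar–Volk 2022, Lemma 11), by
`KumarVolk.lemma_11_general`. [cite: KumarVolk2022b, Lemma 11] -/
theorem kumarVolk2022_lemma_11_holds : kumarVolk2022_lemma_11 := by
  intro K _ _ n d hd hdK m M hdeg hnf β Q hβ hQ hdet
  exact KumarVolk.lemma_11_general hd hdK M hdeg hnf β Q hβ hQ hdet

/-- **Discharge of `kumarVolk2022_thm_1`** (Kumar–Volk 2022, Theorem 1: for `n ≥ 6`,
`dc_ℂ(Σ_{i≤n} x_i^n) ≥ 1.5 n − 3`), by `KumarVolk.thm_1_general` at `K = ℂ`.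
[cite: KumarVolk2022b, Thm. 1] -/
theorem kumarVolk2022_thm_1_holds : kumarVolk2022_thm_1 := by
  intro n hn
  exact KumarVolk.thm_1_general ℂ (by omega) (by exact_mod_cast (show n ≠ 0 by omega))

end Literature.Computability.AlgebraicComplexity

end
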